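import Literature.NumberTheory.Automorphic.Liu2021.Def411WeilCarriersAtChiSplittingOmega
import HarnessLib

/-!
# [Liu2021, Def. 4.11]'s `ω(μ, ε, χ) = ⊗'_v ω(μ_v, ε_v, χ_v)` AT THE `χ`-ATTACHED SPLITTING: the carrier lands in the restricted
# tensor product of the LOCAL central coinvariants of the `θ`-package (the `⊗'` socket of the split-place model)

Topic `NumberTheory/Automorphic/Liu2021`; namespaces `Literature.NumberTheory.GelbartRogawski1991.UnitaryDualPair.WeilCoinv` (§1–§2,
generic in the family `𝓢`) and `Literature.NumberTheory.Automorphic.Liu2021.Def411WeilCarriers` (§3).  KERNEL ONLY: theorems; no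
definition, no named fact, no `sorry`.

Sequel of `Def411WeilCarriersAtChiSplittingOmega` (★: `ω(μ,ε,χ)` at THE `θ`-splitting ≅ the central `χ`-quotient
`Coinv(Ω_θ ∘ (u ↦ u·1_n), χ)` of the place-assembled Weil representation `Ω_θ = 𝓢_θ.Omega`, with its `U(J_V)(𝔸_f)`-action
`k ↦ Ω_θ(reindex(k ⊗ 1))`).  Here that quotient is put in the `⊗'` currency of ★ `FinLocalSplittings.omegaPi_centralCoinv`:

* §1 `exists_isRestrictedTensorProductRep_omegaPi_center` — for ANY family `𝓢` of local splittings of the big line datum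
  `U(J_V ⊗ J_W)`, `J_W` a line, and any continuous character `χ₁` of the centre `E¹(𝔸_{F,f})` whose unramified classes survive off
  a finite `S₁`: the `Πʳ_v [U(J_{VW})(F_v), U(J_{VW})(𝒪_v)]`-representation `TwistedCoinv.rep (charOfCenter χ₁) 𝓢.OmegaPi _` on
  `Coinv(Ω_Π ∘ Πʳ(u ↦ u·1_n), charOfCenter χ₁)` IS `IsRestrictedTensorProductRep` of the LOCAL central coinvariants
  `Θ_v := TwistedCoinv.rep (localCharOfCenter χ₁ v) (𝓢.omegaLoc v) _` w.r.t. the classes `[1_{𝒪_vⁿ}]` (∃ of the comparison map `J`;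
  ★ `isRestrictedTensorProductRep_finiteAdeleRep`, `exists_centralCoinvMap`, `omegaPi_centralCoinv` — the first step of ★
  `omegaPi_centralCoinv_isIrreducible`, stopped before Flath);
* §2 `exists_equiv_omega_center_omegaPi_center` — the explicit `E : Coinv(𝓢.Omega ∘ (u ↦ u·1_n), χ₁) ≃ₗ Coinv(Ω_Π ∘ Πʳ(u ↦ u·1_n),
  charOfCenter χ₁)` (the SAME submodule: ★ `finAdelicEquiv_finAdelicCenter_eq_mapAlong`, `charOfCenter_comp`, `Omega_apply`,
  `TwistedCoinv.ker_comp_of_surjective`), `E [f] = [f]`, intertwining `k ↦ Ω(reindex(k ⊗ 1))` with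
  `Ω_Π (finAdelicEquiv (reindex(k ⊗ 1)))`;
* §3 `exists_isRestrictedTensorProductRep_chiSplittingLine_omegaPi_center` — for THE `θ`-splitting: §1 at the `θ`-package
  `𝓢_θ := congrW … (undoubledSplittings 𝓕)` and the central character `χ` of `Chi`, the survival set supplied by ★ `survival_atLine` —
  so that `ω(μ,ε,χ)|_{⟨a⟩}` (★ `exists_equiv_rhoVAtLine_chiSplittingLine_omega_center`, then §2) is equivariantly isomorphic to a
  representation that IS `⊗'_v` of the local central coinvariants of the `θ`-package: [Liu2021, Def. 4.11 l. 2092–2096] for THE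
  splitting of App. D Step 2 (the composite `T.trans E` is left to the consumer: two `obtain`s).

Consumer: the d6 line of cell `hodgecm-mathlib` (card S4c-2/S4c: the global→local socket feeding the one-index lemma of a
restricted tensor product at a split place `v⁺` and the local split-place model).  HC_CM is NOT proved by anything here.

## References
* [Liu2021] Y. Liu, Camb. J. Math. 9 (2021) = arXiv:2102.11518, Def. 4.11 (l. 2092–2096), App. D §D.1 Steps 1–3 (l. 5217–5221).
* [Flath1979] D. Flath, *Decomposition of representations into tensor products*, PSPM 33 part 1 (1979), Thm. 2, Ex. 2.
* [GelbartRogawski1991] S. Gelbart, J. Rogawski, Invent. Math. 105 (1991), §3.1 Prop. 3.1.1 p. 455 L1–3, Remark p. 457 L4–13.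
-/

set_option autoImplicit false

noncomputable section

open scoped Matrix Kronecker TensorProduct Classical RestrictedProduct
open NumberField NumberField.mixedEmbedding IsDedekindDomain Filter Set
open Literature.NumberTheory Literature.NumberTheory.Automorphic Literature.NumberTheory.Automorphic.UnitaryGroup
open Literature.NumberTheory.Weil1964 Literature.RepresentationTheory
open Literature.RepresentationTheory.HeisenbergGroup

/-! ## §1 The central coinvariants of `Ω_Π` ARE `⊗'_v` of the local central coinvariants (∃ of the comparison map) -/

namespace Literature.NumberTheory.GelbartRogawski1991.UnitaryDualPair.WeilCoinv

variable (F E : Type) [Field F] [NumberField F] [Field E] [NumberField E] [Algebra F E]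
variable (c : E ≃ₐ[F] E) (N : ℕ) {n : ℕ} (e : Fin N × Fin 1 ≃ Fin n)
variable (JV : Matrix (Fin N) (Fin N) E) (JW : Matrix (Fin 1) (Fin 1) E)
variable {TV : Matrix (Fin N) (Fin N) F} {TW : Matrix (Fin 1) (Fin 1) F}
variable [Algebra.IsQuadraticExtension F E] {δ : E} (hcδ : c δ = -δ) (hδ : δ ≠ 0) {d : F}
  (hd : δ * δ = algebraMap F E d) (hV : TV.IsSymm) (hW : TW.IsSymm)
  (hJV : JV = TV.map (algebraMap F E)) (hJW : JW = TW.map (algebraMap F E)) (hJW0 : JW 0 0 ≠ 0)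
  (𝓢 : LocalSplitting.FinLocalSplittings F E c n hcδ hδ hd (gram F e TV TW) (isSymm_gram F e hV hW)
    (reindex_kronecker_eq_gram_map F E e hJV hJW))

-- statement budget: ONE restricted-product spelling of the centre (`mapAlongMonoidHom … (Eventually.of_forall …)`), as ★
-- `commute_mapAlong_localCenter` (≈ 161 k for the statement alone, B-p08 HB160 probe)
set_option maxHeartbeats 400000 in
/-- **the `Ω_Π`-operators commute with the centre read as `Πʳ_v (u_v ↦ u_v·1_n)`** (every element of `Πʳ_v [U(J_W)(F_v), U(J_W)(𝒪_v)]`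
is `finAdelicEquiv (u·1_1)`, ★ `finAdelicEquiv_comp_finAdelicCenter_surjective`; then ★ `commute_mapAlong_localCenter`) — the `hcomm`
input of ★ `FinLocalSplittings.omegaPi_centralCoinv` at the centre, as a named lemma (so that its restricted-product spelling is
elaborated once). [cite: Liu2021, App. D §D.1 Step 3 (l. 5221)] -/
theorem commute_omegaPi_mapAlong_localCenter
    (g : Πʳ v : HeightOneSpectrum (𝓞 F), [localPi E c n (Matrix.reindex e e (JV ⊗ₖ JW)) v,
      localInt E c n (Matrix.reindex e e (JV ⊗ₖ JW)) v])
    (h' : Πʳ v : HeightOneSpectrum (𝓞 F), [localPi E c 1 JW v, localInt E c 1 JW v]) :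
    Commute (𝓢.OmegaPi g)
      ((𝓢.OmegaPi.comp (RestrictedProduct.mapAlongMonoidHom (fun v => localPi E c 1 JW v)
          (fun v => localPi E c n (Matrix.reindex e e (JV ⊗ₖ JW)) v) id Filter.tendsto_id
          (fun v => localCenter E c n (Matrix.reindex e e (JV ⊗ₖ JW)) JW hJW0 v)
          (Eventually.of_forall fun v => localCenter_mapsTo_localInt E c n (Matrix.reindex e e (JV ⊗ₖ JW)) JW hJW0 v))) h') := by
  obtain ⟨u, rfl⟩ := finAdelicEquiv_comp_finAdelicCenter_surjective F E c JW hJW0 h'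
  exact (commute_mapAlong_localCenter F E c N e JV JW hJW0 g u).map 𝓢.OmegaPi

include hJW0 in
set_option maxHeartbeats 400000 in -- measured (200 k, 400 k]: statement carries the commuting lemma's restricted-product type
/-- **The central `χ₁`-quotient of `Ω_Π = ⊗'_v ω_v` IS the restricted tensor product of the LOCAL central `χ_{1,v}`-quotients**
(∃ of the comparison map): for a family `𝓢` of local splittings of `U(J_V ⊗ J_W)`, `J_W` a line, a continuous character `χ₁` of
`E¹(𝔸_{F,f})` and a finite `S₁` off which the class `[1_{𝒪_vⁿ}]` survives, `TwistedCoinv.rep (charOfCenter χ₁) 𝓢.OmegaPi _` on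
`Coinv(Ω_Π ∘ Πʳ(u ↦ u·1_n), charOfCenter χ₁)` is `IsRestrictedTensorProductRep` of
`Θ_v := TwistedCoinv.rep (localCharOfCenter χ₁ v) (𝓢.omegaLoc v) _` (★ `isRestrictedTensorProductRep_finiteAdeleRep` +
`exists_centralCoinvMap` + `omegaPi_centralCoinv`, instantiated at the centre as in ★ `omega_center_isIrreducible_of_local`).
[cite: Liu2021, Def. 4.11 (l. 2092–2096), App. D §D.1 Step 3 (l. 5221)] [cite: Flath1979, §2  Example 2] -/
theorem exists_isRestrictedTensorProductRep_omegaPi_center {χ₁ : finAdelicOne F E c →* ℂˣ} (hχ₁ : Continuous χ₁)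
    {S₁ : Finset (HeightOneSpectrum (𝓞 F))}
    (hx₀N : ∀ v ∉ S₁,
      TwistedCoinv.mk (show Representation ℂ (localPi E c 1 JW v) _ from
          (𝓢.omegaLoc v).comp (localCenter E c n (Matrix.reindex e e (JV ⊗ₖ JW)) JW hJW0 v))
        (localCharOfCenter F E c JW hJW0 χ₁ v) (unitVec F (Fin n) v) ≠ 0) :
    ∃ J, IsRestrictedTensorProductRep
        (fun v => TwistedCoinv.rep (localCharOfCenter F E c JW hJW0 χ₁ v) (𝓢.omegaLoc v)
          (commute_omegaLoc_localCenter F E c N e JV JW hcδ hδ hd hV hW hJV hJW hJW0 𝓢 v))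
        (TwistedCoinv.rep (charOfCenter F E c JW hJW0 χ₁) 𝓢.OmegaPi
          (commute_omegaPi_mapAlong_localCenter F E c N e JV JW hcδ hδ hd hV hW hJV hJW hJW0 𝓢))
        (IsRestrictedTensorProductRep.eventually_mk_mem_fixedPoints
          (commute_omegaLoc_localCenter F E c N e JV JW hcδ hδ hd hV hW hJV hJW hJW0 𝓢) 𝓢.unitVec_mem_fixedPoints)
        J S₁ := by
  obtain ⟨J, hJ⟩ :=
    (isRestrictedTensorProductRep_finiteAdeleRep F (Fin n) 𝓢.omegaLoc 𝓢.unitVec_mem_fixedPoints).exists_centralCoinvMap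
      (φ := fun v => localCenter E c n (Matrix.reindex e e (JV ⊗ₖ JW)) JW hJW0 v)
      (hφ := Eventually.of_forall fun v => localCenter_mapsTo_localInt E c n (Matrix.reindex e e (JV ⊗ₖ JW)) JW hJW0 v)
      (χloc := fun v => localCharOfCenter F E c JW hJW0 χ₁ v) (hq := Filter.Eventually.of_forall fun _ => rfl)
      (charOfCenter F E c JW hJW0 χ₁) (coe_charOfCenter_eq_finprod F E c JW hJW0 hχ₁)
  exact ⟨J, 𝓢.omegaPi_centralCoinv (fun v => localCenter E c n (Matrix.reindex e e (JV ⊗ₖ JW)) JW hJW0 v)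
    (Eventually.of_forall fun v => localCenter_mapsTo_localInt E c n (Matrix.reindex e e (JV ⊗ₖ JW)) JW hJW0 v)
    (commute_omegaLoc_localCenter F E c N e JV JW hcδ hδ hd hV hW hJV hJW hJW0 𝓢)
    (commute_omegaPi_mapAlong_localCenter F E c N e JV JW hcδ hδ hd hV hW hJV hJW hJW0 𝓢)
    (charOfCenter F E c JW hJW0 χ₁) (coe_charOfCenter_eq_finprod F E c JW hJW0 hχ₁)
    (eventually_localCharOfCenter_eq_one F E c JW hJW0 hχ₁) hx₀N _ J hJ⟩

/-! ## §2 `Coinv(Ω ∘ (u ↦ u·1_n), χ₁)` on `U(J_V)(𝔸_f)` IS `Coinv(Ω_Π ∘ Πʳ(u ↦ u·1_n), charOfCenter χ₁)` on `Πʳ_v U(J_{VW})(F_v)` -/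

include hJW0 in
set_option maxHeartbeats 1600000 in -- measured (800 k, 1.6 M]: statement elaboration (two coinvariant presentations of the centre)
/-- **The two presentations of the central quotient are the quotient by the SAME submodule**, hence an explicit
`E : Coinv(𝓢.Omega ∘ (u ↦ u·1_n), χ₁) ≃ₗ Coinv(𝓢.OmegaPi ∘ Πʳ(u ↦ u·1_n), charOfCenter χ₁)` with `E [f] = [f]`, intertwining the
`U(J_V)(𝔸_f)`-action `k ↦ Ω(reindex(k ⊗ 1))` with `Ω_Π (finAdelicEquiv (reindex(k ⊗ 1)))` (`Ω = Ω_Π ∘ finAdelicEquiv`, ★ `Omega_apply`;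
`finAdelicEquiv (u·1_n) = Πʳ(u_v·1_n)`, ★ `finAdelicEquiv_finAdelicCenter_eq_mapAlong`; `charOfCenter χ₁ ∘ (finAdelicEquiv ∘ (u ↦ u·1_1)) = χ₁`,
★ `charOfCenter_comp`; surjectivity ★ `finAdelicEquiv_comp_finAdelicCenter_surjective`, ★ `TwistedCoinv.ker_comp_of_surjective`).
[cite: Liu2021, App. D §D.1 Step 3 (l. 5221)] [cite: GelbartRogawski1991, §3.1 Prop. 3.1.1 p. 455 L1–3] -/
theorem exists_equiv_omega_center_omegaPi_center (χ₁ : finAdelicOne F E c →* ℂˣ) :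
    ∃ E' : TwistedCoinv.Coinv
          (show Representation ℂ (finAdelicOne F E c) _ from
            𝓢.Omega.comp (finAdelicCenter F E c n (Matrix.reindex e e (JV ⊗ₖ JW)))) χ₁ ≃ₗ[ℂ]
        TwistedCoinv.Coinv (𝓢.OmegaPi.comp (RestrictedProduct.mapAlongMonoidHom (fun v => localPi E c 1 JW v)
          (fun v => localPi E c n (Matrix.reindex e e (JV ⊗ₖ JW)) v) id Filter.tendsto_id
          (fun v => localCenter E c n (Matrix.reindex e e (JV ⊗ₖ JW)) JW hJW0 v)
          (Eventually.of_forall fun v => localCenter_mapsTo_localInt E c n (Matrix.reindex e e (JV ⊗ₖ JW)) JW hJW0 v))) (charOfCenter F E c JW hJW0 χ₁),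
      (∀ f : FinSB F (Fin n), E' (TwistedCoinv.mk _ χ₁ f) = TwistedCoinv.mk _ (charOfCenter F E c JW hJW0 χ₁) f) ∧
      ∀ (k : finAdelic F E c N JV)
        (x : TwistedCoinv.Coinv (show Representation ℂ (finAdelicOne F E c) _ from
          𝓢.Omega.comp (finAdelicCenter F E c n (Matrix.reindex e e (JV ⊗ₖ JW)))) χ₁),
        E' (TwistedCoinv.rep χ₁
            (show Representation ℂ (finAdelic F E c N JV) _ from
              𝓢.Omega.comp ((finPairEmb F E c N 1 e JV JW).comp (MonoidHom.inl _ _)))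
            (commute_omega_finPairEmb_finAdelicCenter F E c N e JV JW hcδ hδ hd hV hW hJV hJW 𝓢) k x) =
          TwistedCoinv.rep (charOfCenter F E c JW hJW0 χ₁) 𝓢.OmegaPi
            (commute_omegaPi_mapAlong_localCenter F E c N e JV JW hcδ hδ hd hV hW hJV hJW hJW0 𝓢)
            (finAdelicEquiv F E c n (Matrix.reindex e e (JV ⊗ₖ JW)) (finPairEmb F E c N 1 e JV JW (k, 1))) (E' x) := by
  -- the restricted-product presentation of the centre, named once
  set ρc : Representation ℂ (Πʳ v : HeightOneSpectrum (𝓞 F), [localPi E c 1 JW v, localInt E c 1 JW v]) (FinSB F (Fin n)) :=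
    𝓢.OmegaPi.comp (RestrictedProduct.mapAlongMonoidHom (fun v => localPi E c 1 JW v)
          (fun v => localPi E c n (Matrix.reindex e e (JV ⊗ₖ JW)) v) id Filter.tendsto_id
          (fun v => localCenter E c n (Matrix.reindex e e (JV ⊗ₖ JW)) JW hJW0 v)
          (Eventually.of_forall fun v => localCenter_mapsTo_localInt E c n (Matrix.reindex e e (JV ⊗ₖ JW)) JW hJW0 v)) with hρc
  -- `ζ = finAdelicEquiv ∘ (u ↦ u·1_1) : E¹(𝔸_f) ↠ Πʳ_v [U(J_W)(F_v), U(J_W)(𝒪_v)]`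
  have hζ := finAdelicEquiv_comp_finAdelicCenter_surjective F E c JW hJW0
  -- the two presentations agree pointwise through `ζ`
  have hρ : (show Representation ℂ (finAdelicOne F E c) _ from
      ρc.comp ((finAdelicEquiv F E c 1 JW).toMonoidHom.comp (finAdelicCenter F E c 1 JW))) =
      (show Representation ℂ (finAdelicOne F E c) _ from
        𝓢.Omega.comp (finAdelicCenter F E c n (Matrix.reindex e e (JV ⊗ₖ JW)))) := by
    refine MonoidHom.ext fun u => LinearMap.ext fun f => ?_
    change ρc (finAdelicEquiv F E c 1 JW (finAdelicCenter F E c 1 JW u)) f =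
      𝓢.Omega (finAdelicCenter F E c n (Matrix.reindex e e (JV ⊗ₖ JW)) u) f
    rw [hρc, 𝓢.Omega_apply, finAdelicEquiv_finAdelicCenter_eq_mapAlong F E c n (Matrix.reindex e e (JV ⊗ₖ JW)) JW hJW0 u]
    rfl
  have hχ : (charOfCenter F E c JW hJW0 χ₁).comp ((finAdelicEquiv F E c 1 JW).toMonoidHom.comp (finAdelicCenter F E c 1 JW)) = χ₁ :=
    charOfCenter_comp F E c JW hJW0 χ₁
  have hker : TwistedCoinv.ker
        (show Representation ℂ (finAdelicOne F E c) _ from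
          𝓢.Omega.comp (finAdelicCenter F E c n (Matrix.reindex e e (JV ⊗ₖ JW)))) χ₁ =
      TwistedCoinv.ker ρc (charOfCenter F E c JW hJW0 χ₁) := by
    have h1 := TwistedCoinv.ker_comp_of_surjective ρc (charOfCenter F E c JW hJW0 χ₁) _ hζ
    have h2 := congrArg₂ (fun (ρ : Representation ℂ (finAdelicOne F E c) (FinSB F (Fin n))) (χ : finAdelicOne F E c →* ℂˣ) =>
      TwistedCoinv.ker ρ χ) hρ hχ
    exact h2.symm.trans h1
  refine ⟨Submodule.quotEquivOfEq _ _ hker, fun f => rfl, fun k x => ?_⟩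
  obtain ⟨f, rfl⟩ := TwistedCoinv.mk_surjective _ χ₁ x
  rw [TwistedCoinv.rep_mk]
  change TwistedCoinv.mk ρc (charOfCenter F E c JW hJW0 χ₁) (𝓢.Omega (finPairEmb F E c N 1 e JV JW (k, 1)) f) =
    TwistedCoinv.rep (charOfCenter F E c JW hJW0 χ₁) 𝓢.OmegaPi
      (commute_omegaPi_mapAlong_localCenter F E c N e JV JW hcδ hδ hd hV hW hJV hJW hJW0 𝓢)
      (finAdelicEquiv F E c n (Matrix.reindex e e (JV ⊗ₖ JW)) (finPairEmb F E c N 1 e JV JW (k, 1)))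
      (TwistedCoinv.mk ρc (charOfCenter F E c JW hJW0 χ₁) f)
  rw [TwistedCoinv.rep_mk, 𝓢.Omega_apply]

end Literature.NumberTheory.GelbartRogawski1991.UnitaryDualPair.WeilCoinv


/-! ## §3 THE `θ`-splitting: `ω(μ,ε,χ)` lands in `⊗'_v` of the local central coinvariants of the `θ`-package -/

namespace Literature.NumberTheory.Automorphic.Liu2021.Def411WeilCarriers

open Literature.NumberTheory.GelbartRogawski1991 Literature.NumberTheory.GelbartRogawski1991.UnitaryDualPair
open Literature.NumberTheory.GelbartRogawski1991.UnitaryDualPair.WeilCoinv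
open Literature.NumberTheory.GelbartRogawski1991.GRConstruction
open Literature.NumberTheory.GaloisRepresentations Literature.RepresentationTheory.HarrisKudlaSweet1996
open Literature.NumberTheory.Automorphic.Liu2021.Def411WeilCarriersDoubling

variable (L : Type) [Field L] [NumberField L] [IsCMField L]
variable {N' n' : ℕ} (e₁ : Fin N' × Fin 1 ≃ Fin n')
  (dV₁ : Fin N' → L) (hdV₁ : ∀ i, IsCMField.complexConj L (dV₁ i) = dV₁ i) (hdV₁0 : ∀ i, dV₁ i ≠ 0)
  (θ : HeckeCharacter L) (hθu : θ.IsUnitary) (hθs : IsSplittingChar L 1 θ)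
  (a : (Fp L)ˣ) (χ : Chi (Fp L) L (IsCMField.complexConj L))
  (𝔪 : ∀ v, PlaceMeasure L v)
  (𝓕 : FinLocalFamily L e₁ dV₁ hdV₁ hdV₁0 (lineW L (TW (Fp L) a)) (complexConj_lineW L (TW (Fp L) a))
    (lineW_ne_zero L (TW (Fp L) a) (isUnit_det_TW (Fp L) a)) θ 𝔪)

include hdV₁0 in
set_option maxHeartbeats 400000 in -- measured (200 k, 400 k]: the `θ`-package instantiation
/-- **[Liu2021, Def. 4.11] «`ω(μ, ε, χ) := ⊗'_v ω(μ_v, ε_v, χ_v)`» for THE `θ`-package**: the representation reached from `ω(μ,ε,χ)|_{⟨a⟩}` by ★ `exists_equiv_rhoVAtLine_chiSplittingLine_omega_center` ∘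
`exists_equiv_omega_center_omegaPi_center` IS `IsRestrictedTensorProductRep` of the local central `χ_v`-coinvariants
`TwistedCoinv.rep (localCharOfCenter χ v) (𝓢_θ.omegaLoc v) _` off the finite survival set of ★ `survival_atLine`
(`exists_isRestrictedTensorProductRep_omegaPi_center` at `𝓢 := 𝓢_θ`, `χ₁ := χ`). [cite: Liu2021, Def. 4.11 (l. 2090–2096), App. D §D.1 Step 3 (l. 5221)]
[cite: Flath1979, §2  Example 2] -/
theorem exists_isRestrictedTensorProductRep_chiSplittingLine_omegaPi_center [NeZero n'] :
    ∃ (S₁ : Finset (HeightOneSpectrum (𝓞 (Fp L)))) (J : _),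
      IsRestrictedTensorProductRep
        (fun v => TwistedCoinv.rep (localCharOfCenter (Fp L) L (IsCMField.complexConj L) (JW (Fp L) L a)
            (JW_apply_ne_zero (Fp L) L a) χ.1 v) ((congrW L e₁ dV₁ hdV₁ (lineW L (TW (Fp L) a)) (complexConj_lineW L (TW (Fp L) a)) (realDiagonal_lineW L (TW (Fp L) a))
              (diagonal_lineW L (TW (Fp L) a) (JW_eq (Fp L) L a))
              (undoubledSplittings L e₁ dV₁ hdV₁ hdV₁0 (lineW L (TW (Fp L) a)) (complexConj_lineW L (TW (Fp L) a))
                (lineW_ne_zero L (TW (Fp L) a) (isUnit_det_TW (Fp L) a)) θ 𝔪 𝓕)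
              (isSymm_TW (Fp L) a) (JW_eq (Fp L) L a)).omegaLoc v)
          (commute_omegaLoc_localCenter (Fp L) L (IsCMField.complexConj L) N' e₁ (Matrix.diagonal dV₁) (JW (Fp L) L a)
            (complexConj_imagUnit L) (imagUnit_ne_zero L) (imagUnit_mul_self L) (realDiagonal_isSymm L dV₁ hdV₁)
            (isSymm_TW (Fp L) a) (realDiagonal_map L dV₁ hdV₁).symm (JW_eq (Fp L) L a) (JW_apply_ne_zero (Fp L) L a) (congrW L e₁ dV₁ hdV₁ (lineW L (TW (Fp L) a)) (complexConj_lineW L (TW (Fp L) a)) (realDiagonal_lineW L (TW (Fp L) a))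
              (diagonal_lineW L (TW (Fp L) a) (JW_eq (Fp L) L a))
              (undoubledSplittings L e₁ dV₁ hdV₁ hdV₁0 (lineW L (TW (Fp L) a)) (complexConj_lineW L (TW (Fp L) a))
                (lineW_ne_zero L (TW (Fp L) a) (isUnit_det_TW (Fp L) a)) θ 𝔪 𝓕)
              (isSymm_TW (Fp L) a) (JW_eq (Fp L) L a)) v))
        (TwistedCoinv.rep (charOfCenter (Fp L) L (IsCMField.complexConj L) (JW (Fp L) L a) (JW_apply_ne_zero (Fp L) L a) χ.1)
          (congrW L e₁ dV₁ hdV₁ (lineW L (TW (Fp L) a)) (complexConj_lineW L (TW (Fp L) a)) (realDiagonal_lineW L (TW (Fp L) a))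
              (diagonal_lineW L (TW (Fp L) a) (JW_eq (Fp L) L a))
              (undoubledSplittings L e₁ dV₁ hdV₁ hdV₁0 (lineW L (TW (Fp L) a)) (complexConj_lineW L (TW (Fp L) a))
                (lineW_ne_zero L (TW (Fp L) a) (isUnit_det_TW (Fp L) a)) θ 𝔪 𝓕)
              (isSymm_TW (Fp L) a) (JW_eq (Fp L) L a)).OmegaPi
          (commute_omegaPi_mapAlong_localCenter (Fp L) L (IsCMField.complexConj L) N' e₁ (Matrix.diagonal dV₁) (JW (Fp L) L a)
            (complexConj_imagUnit L) (imagUnit_ne_zero L) (imagUnit_mul_self L) (realDiagonal_isSymm L dV₁ hdV₁)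
            (isSymm_TW (Fp L) a) (realDiagonal_map L dV₁ hdV₁).symm (JW_eq (Fp L) L a) (JW_apply_ne_zero (Fp L) L a) (congrW L e₁ dV₁ hdV₁ (lineW L (TW (Fp L) a)) (complexConj_lineW L (TW (Fp L) a)) (realDiagonal_lineW L (TW (Fp L) a))
              (diagonal_lineW L (TW (Fp L) a) (JW_eq (Fp L) L a))
              (undoubledSplittings L e₁ dV₁ hdV₁ hdV₁0 (lineW L (TW (Fp L) a)) (complexConj_lineW L (TW (Fp L) a))
                (lineW_ne_zero L (TW (Fp L) a) (isUnit_det_TW (Fp L) a)) θ 𝔪 𝓕)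
              (isSymm_TW (Fp L) a) (JW_eq (Fp L) L a))))
        (IsRestrictedTensorProductRep.eventually_mk_mem_fixedPoints
          (commute_omegaLoc_localCenter (Fp L) L (IsCMField.complexConj L) N' e₁ (Matrix.diagonal dV₁) (JW (Fp L) L a)
            (complexConj_imagUnit L) (imagUnit_ne_zero L) (imagUnit_mul_self L) (realDiagonal_isSymm L dV₁ hdV₁)
            (isSymm_TW (Fp L) a) (realDiagonal_map L dV₁ hdV₁).symm (JW_eq (Fp L) L a) (JW_apply_ne_zero (Fp L) L a) (congrW L e₁ dV₁ hdV₁ (lineW L (TW (Fp L) a)) (complexConj_lineW L (TW (Fp L) a)) (realDiagonal_lineW L (TW (Fp L) a))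
              (diagonal_lineW L (TW (Fp L) a) (JW_eq (Fp L) L a))
              (undoubledSplittings L e₁ dV₁ hdV₁ hdV₁0 (lineW L (TW (Fp L) a)) (complexConj_lineW L (TW (Fp L) a))
                (lineW_ne_zero L (TW (Fp L) a) (isUnit_det_TW (Fp L) a)) θ 𝔪 𝓕)
              (isSymm_TW (Fp L) a) (JW_eq (Fp L) L a)))
          (congrW L e₁ dV₁ hdV₁ (lineW L (TW (Fp L) a)) (complexConj_lineW L (TW (Fp L) a)) (realDiagonal_lineW L (TW (Fp L) a))
              (diagonal_lineW L (TW (Fp L) a) (JW_eq (Fp L) L a))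
              (undoubledSplittings L e₁ dV₁ hdV₁ hdV₁0 (lineW L (TW (Fp L) a)) (complexConj_lineW L (TW (Fp L) a))
                (lineW_ne_zero L (TW (Fp L) a) (isUnit_det_TW (Fp L) a)) θ 𝔪 𝓕)
              (isSymm_TW (Fp L) a) (JW_eq (Fp L) L a)).unitVec_mem_fixedPoints)
        J S₁ := by
  have hS := survival_atLine (Fp L) L (IsCMField.complexConj L) N' e₁ (Matrix.diagonal dV₁) (complexConj_imagUnit L)
    (imagUnit_ne_zero L) (imagUnit_mul_self L) (realDiagonal_isSymm L dV₁ hdV₁) (isUnit_det_realDiagonal L dV₁ hdV₁ hdV₁0)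
    (realDiagonal_map L dV₁ hdV₁).symm a χ (congrW L e₁ dV₁ hdV₁ (lineW L (TW (Fp L) a)) (complexConj_lineW L (TW (Fp L) a)) (realDiagonal_lineW L (TW (Fp L) a))
              (diagonal_lineW L (TW (Fp L) a) (JW_eq (Fp L) L a))
              (undoubledSplittings L e₁ dV₁ hdV₁ hdV₁0 (lineW L (TW (Fp L) a)) (complexConj_lineW L (TW (Fp L) a))
                (lineW_ne_zero L (TW (Fp L) a) (isUnit_det_TW (Fp L) a)) θ 𝔪 𝓕)
              (isSymm_TW (Fp L) a) (JW_eq (Fp L) L a))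
  obtain ⟨S₁, hS₁⟩ := hS
  have hJ := exists_isRestrictedTensorProductRep_omegaPi_center (Fp L) L (IsCMField.complexConj L) N' e₁ (Matrix.diagonal dV₁)
    (JW (Fp L) L a) (complexConj_imagUnit L) (imagUnit_ne_zero L) (imagUnit_mul_self L) (realDiagonal_isSymm L dV₁ hdV₁)
    (isSymm_TW (Fp L) a) (realDiagonal_map L dV₁ hdV₁).symm (JW_eq (Fp L) L a) (JW_apply_ne_zero (Fp L) L a) (congrW L e₁ dV₁ hdV₁ (lineW L (TW (Fp L) a)) (complexConj_lineW L (TW (Fp L) a)) (realDiagonal_lineW L (TW (Fp L) a))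
              (diagonal_lineW L (TW (Fp L) a) (JW_eq (Fp L) L a))
              (undoubledSplittings L e₁ dV₁ hdV₁ hdV₁0 (lineW L (TW (Fp L) a)) (complexConj_lineW L (TW (Fp L) a))
                (lineW_ne_zero L (TW (Fp L) a) (isUnit_det_TW (Fp L) a)) θ 𝔪 𝓕)
              (isSymm_TW (Fp L) a) (JW_eq (Fp L) L a)) χ.2.1 hS₁
  obtain ⟨J, hJ'⟩ := hJ
  exact ⟨S₁, J, hJ'⟩

end Literature.NumberTheory.Automorphic.Liu2021.Def411WeilCarriers

end
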